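import Literature.AlgebraicGeometry.ShimuraVarieties.UnitaryCurveAuxiliaryFrameDataV
import Literature.AlgebraicGeometry.ShimuraVarieties.UnitaryCurveAuxiliaryPeriodLieType
import Literature.NumberTheory.Adeles.CompactSubgroupStabilisesLatticeCommutant
import HarnessLib

/-!
# An `𝓞_M`-STABLE adapted frame: the `𝒪`-action on `V_M` reads as INTEGER matrices `ρ : 𝓞 M →+* M_{2g}(ℤ)` in a symplectic frame
# adapted to a `K`-stable `𝓞_M`-lattice (Rosati and commutation included), any rank `n`

Topic `AlgebraicGeometry/ShimuraVarieties`; namespace `Literature.AlgebraicGeometry.ShimuraVarieties.UnitaryCurve.AuxV`.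
Theorems only (no definition, no named fact, no instance).  Cell `hodgecm-mathlib` (D-0151), FLOOR 0, P6 «MOD programme», door (E) of
`stub_RGD`, organ **E1 FILE 7b (part 2 of 2)** — the (M) fields of the E-LINE chart `AuxChartGS` of `Cruxes/HLiu418/Lines/F0_P6a_PELWitnessE.lean`
(`Mρ : 𝓞 F →+* Matrix (Fin g ⊕ Fin g) (Fin g ⊕ Fin g) ℤ`, `Mρ_rosati`, and the commutation of `Mρ` with the carrier used by E2's
`Mρ_kottwitz` ∕ E6's `Mρ_comm_auxRep`).  `--supports stmt-HodgeConjecture-24832`, count-neutral; HC_CM is proved only modulo the printed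
citations until rung 0 closes.

THE POINT ([Kottwitz1992] §5 p. 390: the PEL moduli problem needs an `𝒪_B`-LATTICE `Λ` stabilised by the level; [RapoportSmithlingZhang2020Diagonal]
§4.1 p. 17: `𝒪_F`-action `ι : 𝒪_F → End(A)` with Rosati `ι(b̄) = ι(b)^†`): the symplectic frame `β` of ★ E1 FILES 5∕6 is adapted to a
`K`-stable **ℤ**-lattice `β⁻¹(ℤ^{2g})`; for multiplication by `b ∈ 𝓞_M` to have an INTEGER matrix in the frame the lattice must moreover be
`𝓞_M`-stable.  ★ `Adeles.exists_rat_conj_entries_mem_integralFiniteAdeles_of_commute` (FILE 7a: a compact subgroup and a commuting order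
stabilise a common lattice) applied to the compact image of `K × L₀` under ★ `auxResFinV` and to the order `{res(b•1) : b ∈ 𝓞_M}`
(which commutes with the `(𝔸_f ⊗ M)`-linear carrier) gives such a lattice; ★ `exists_symplecticFrameV_integral` adapts the frame.

* (part 1, ★ `UnitaryCurveAuxiliaryFrameDataV`: `resMatrix_map_algebraMap`, `coe_auxRepV_scalar_eq_map`, `auxRepV_scalar_mul_comm`,
  `prod_le_auxLevelV_one_of_framePV_eq`, `exists_ringHom_reading_of_framePV_eq`.)
* §1 HEAD **`exists_symplecticFrameV_integralAction`**: `∃ k g δ (Fr : SymplecticFrameV M j H (k•ξ) g δ) (ρ : 𝓞 M →+* M_{2g}(ℤ)),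
  0 < k ∧ 0 < g ∧ IsPolarizationType δ ∧ K.prod L₀ ≤ auxLevelV Fr 1 ∧ ∀ b, (ρ b).map Int.cast = framePV Fr * resMatrix (ratBasis M) ((b:M) • 1) * frameQV Fr`.
* §2 consequences for ANY such reading `ρ`: `reading_transpose_mul_typeForm` (ℤ-ROSATI in GEN's token shape
  `(b' : M) = c b → (ρ b')ᵀ * typeForm δ = typeForm δ * ρ b`, from A-p17's ★ `transpose_frame_scalar_mul_typeFormOver`),
  `map_intCast_reading_eq_coe_auxRepV` (`(ρ b)_R = auxRepV R Fr (1⊗b, 1)` for every `ℚ`-algebra `R`: the real avatar `N_b` of ★ E2 FILE D and the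
  adelic one), `map_intCast_reading_mul_auxRepV_comm` (`(ρ b)_R` commutes with every `auxRepV R Fr p` — E6's `Mρ_comm_auxRep`, E2's `J`-linearity).

## References
* [Kottwitz1992] R. Kottwitz, *Points on some Shimura varieties over finite fields*, JAMS 5 (1992), §5 p. 390.
* [RapoportSmithlingZhang2020Diagonal] M. Rapoport, B. Smithling, W. Zhang, Compos. Math. 156 (2020), Remark 3.2 (ii)(iii) pp. 9–10, §4.1 p. 17.
* [Deligne1979ShimuraVarieties] P. Deligne, *Variétés de Shimura* (1979), Prop. 2.3.10 (PDF p. 32 of Milne's translation).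
* [Milne2005ShimuraVarieties] J. S. Milne, *Introduction to Shimura varieties* (2005), §6 p. 67, §8 p. 81.
* [PlatonovRapinchuk1994] V. Platonov, A. Rapinchuk, *Algebraic groups and number theory* (1994), §8.1.
-/

set_option autoImplicit false

noncomputable section

open Matrix NumberField IsDedekindDomain
open scoped TensorProduct
open Literature.AlgebraicGeometry.ModuliOfAbelianVarieties Literature.LinearAlgebra.FreeModule
open Literature.NumberTheory.Automorphic (integralFiniteAdeles)

namespace Literature.AlgebraicGeometry.ShimuraVarieties

namespace UnitaryCurve

namespace AuxV

open Literature.AlgebraicGeometry.ShimuraVarieties.UnitaryCanonicalModel.Aux (ratBasis torusFinAdelic torusToTensorFin map_intCast_mul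
  isCongOne_one_of_forall_mem_integral forall_mem_integral_intConj)
open Literature.AlgebraicGeometry.ShimuraVarieties.UnitaryCurve.Aux (unitaryToTensorFin)
open Literature.NumberTheory.Automorphic Literature.NumberTheory.Automorphic.UnitaryGroup

/-- An integer matrix is determined by its rational image. [cite: PlatonovRapinchuk1994, §8.1] -/
private theorem map_intCast_injective' {m m' : Type} :
    Function.Injective (fun A : Matrix m m' ℤ => A.map (Int.cast : ℤ → ℚ)) := fun A B h => by
  ext i k
  have := congrFun (congrFun h i) k
  simpa only [Matrix.map_apply, Int.cast_inj] using this

/-! ### §1. The `𝓞_M`-stable adapted frame -/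

section Main

variable {L : Type} [Field L] [NumberField L] [IsCMField L] {M : Type} [Field M] [NumberField M] [IsCMField M]
  (j : L →+* M) {n : ℕ} (H : Matrix (Fin n) (Fin n) L) (ξ : M)

/-- **The `𝒪`-action reads integrally in a suitable adapted frame** (Deligne's auxiliary construction with Kottwitz's `𝒪_B`-lattice, `W₀`-free):
for `H^j` hermitian, `H` invertible, `ξ` nonzero purely imaginary, `n ≠ 0` and compact `K ≤ U(H)(𝔸_f)`, `L₀ ≤ T₀(M)(𝔸_f)` there are `k > 0`, `g > 0`,
a polarisation type `δ`, a symplectic frame `Fr` of type `δ` for `auxFormV M j H (k•ξ)` AND an integer ring homomorphism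
`ρ : 𝓞 M →+* M_{2g}(ℤ)` with `K × L₀ ≤ K̃_V(1)` and `(ρ b)_ℚ = P·res(b•1)·Q` (multiplication by `b` on `V_M` in the frame): the frame's lattice is
`K`-stable AND `𝓞_M`-stable. [cite: Kottwitz1992, §5 p. 390] [cite: Deligne1979ShimuraVarieties, Prop. 2.3.10 (PDF p. 32)]
[cite: RapoportSmithlingZhang2020Diagonal, Remark 3.2 (ii)(iii) pp. 9–10, §4.1 p. 17] -/
theorem exists_symplecticFrameV_integralAction [NeZero n] (hH : (H.map j)ᴴ = H.map j) (hHu : IsUnit H) (hξ : ξ ≠ 0)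
    (hξc : IsCMField.complexConj M ξ = -ξ)
    (K : Subgroup ↥(finAdelic (↥(maximalRealSubfield L)) L (IsCMField.complexConj L) n H))
    (L₀ : Subgroup ↥(torusFinAdelic M))
    (hK : IsCompact (K : Set ↥(finAdelic (↥(maximalRealSubfield L)) L (IsCMField.complexConj L) n H)))
    (hL₀ : IsCompact (L₀ : Set ↥(torusFinAdelic M))) :
    ∃ (k g : ℕ) (δ : Fin g → ℕ) (Fr : SymplecticFrameV M j H ((k : ℚ) • ξ) g δ)
      (ρ : 𝓞 M →+* Matrix (Fin g ⊕ Fin g) (Fin g ⊕ Fin g) ℤ),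
      0 < k ∧ 0 < g ∧ IsPolarizationType δ ∧ K.prod L₀ ≤ auxLevelV Fr 1 ∧
        ∀ b : 𝓞 M, (ρ b).map (Int.cast : ℤ → ℚ) =
          framePV Fr * resMatrix (m := Fin n) (ratBasis M) (((b : 𝓞 M) : M) • (1 : Matrix (Fin n) (Fin n) M)) * frameQV Fr := by
  classical
  -- the compact image `C` of `K × L₀` under the frame-free carrier
  set C : Subgroup (GL (Fin n × Fin (Module.finrank ℚ M)) finAdeleQ) := (K.prod L₀).map (auxResFinV M j H) with hC
  have hCc : IsCompact (C : Set (GL (Fin n × Fin (Module.finrank ℚ M)) finAdeleQ)) := by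
    rw [hC, Subgroup.coe_map, Subgroup.coe_prod]
    exact (hK.prod hL₀).image (continuous_auxResFinV M j H)
  -- the order `res(𝓞_M • 1)` through an integral basis, and its commutation with `C`
  let σ : 𝓞 M →+* Matrix (Fin n × Fin (Module.finrank ℚ M)) (Fin n × Fin (Module.finrank ℚ M)) ℚ :=
    (resMatrix (m := Fin n) (ratBasis M)).comp ((algebraMap M (Matrix (Fin n) (Fin n) M)).comp (algebraMap (𝓞 M) M))
  have hσ : ∀ b : 𝓞 M, σ b = resMatrix (m := Fin n) (ratBasis M) (((b : 𝓞 M) : M) • (1 : Matrix (Fin n) (Fin n) M)) := fun b => by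
    simp only [σ, RingHom.comp_apply, Algebra.algebraMap_eq_smul_one]
  let bO := RingOfIntegers.basis M
  let S : Module.Free.ChooseBasisIndex ℤ (𝓞 M) → Matrix (Fin n × Fin (Module.finrank ℚ M)) (Fin n × Fin (Module.finrank ℚ M)) ℚ :=
    fun l => σ (bO l)
  have hspan : ∀ b : 𝓞 M, σ b ∈ Submodule.span ℤ (Set.range S) := by
    intro b
    have hb : b ∈ Submodule.span ℤ (Set.range bO) := by rw [bO.span_eq]; trivial
    rw [show Set.range S = σ.toIntAlgHom.toLinearMap '' Set.range bO from by
      rw [← Set.range_comp]; rfl, Submodule.span_image]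
    exact Submodule.mem_map_of_mem hb
  have h1 : (1 : Matrix _ _ ℚ) ∈ Submodule.span ℤ (Set.range S) := by
    have h := hspan 1
    rwa [map_one] at h
  have hmul : ∀ l l', S l * S l' ∈ Submodule.span ℤ (Set.range S) := fun l l' => by
    have h := hspan (bO l * bO l')
    rwa [map_mul] at h
  have hcommσ : ∀ (b : 𝓞 M) (p : ↥(finAdelic (↥(maximalRealSubfield L)) L (IsCMField.complexConj L) n H) × ↥(torusFinAdelic M)),
      (σ b).map (algebraMap ℚ finAdeleQ) * ((auxResFinV M j H p : GL (Fin n × Fin (Module.finrank ℚ M)) finAdeleQ) :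
          Matrix (Fin n × Fin (Module.finrank ℚ M)) (Fin n × Fin (Module.finrank ℚ M)) finAdeleQ) =
        ((auxResFinV M j H p : GL (Fin n × Fin (Module.finrank ℚ M)) finAdeleQ) :
          Matrix (Fin n × Fin (Module.finrank ℚ M)) (Fin n × Fin (Module.finrank ℚ M)) finAdeleQ) * (σ b).map (algebraMap ℚ finAdeleQ) := by
    intro b p
    rw [hσ, resMatrix_map_algebraMap, coe_auxResFinV, ← map_mul, ← map_mul,
      Matrix.map_smul' _ _ _ (map_mul (Algebra.TensorProduct.includeRight : M →ₐ[ℚ] finAdeleQ ⊗[ℚ] M)),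
      Matrix.map_one _ (map_zero _) (map_one _), smul_one_mul, mul_smul_one]
  have hcomm : ∀ l, ∀ c ∈ C, (S l).map (algebraMap ℚ finAdeleQ) * (c : Matrix _ _ finAdeleQ) =
      (c : Matrix _ _ finAdeleQ) * (S l).map (algebraMap ℚ finAdeleQ) := by
    intro l c hc
    rw [hC] at hc
    obtain ⟨p, -, rfl⟩ := Subgroup.mem_map.mp hc
    exact hcommσ (bO l) p
  obtain ⟨γ, hγ, hγS⟩ :=
    Literature.NumberTheory.Adeles.exists_rat_conj_entries_mem_integralFiniteAdeles_of_commute C hCc S h1 hmul hcomm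
  -- the `γ`-twisted rational basis `c` and the integral frame adapted to it
  set e : Module.Basis (Fin n × Fin (Module.finrank ℚ M)) ℚ (Fin n → M) := resBasis (m := Fin n) (ratBasis M) with he
  set γm : Matrix (Fin n × Fin (Module.finrank ℚ M)) (Fin n × Fin (Module.finrank ℚ M)) ℚ :=
    ((γ : GL (Fin n × Fin (Module.finrank ℚ M)) ℚ) : Matrix (Fin n × Fin (Module.finrank ℚ M)) (Fin n × Fin (Module.finrank ℚ M)) ℚ)
    with hγm
  set γi : Matrix (Fin n × Fin (Module.finrank ℚ M)) (Fin n × Fin (Module.finrank ℚ M)) ℚ :=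
    ((γ⁻¹ : GL (Fin n × Fin (Module.finrank ℚ M)) ℚ) : Matrix (Fin n × Fin (Module.finrank ℚ M)) (Fin n × Fin (Module.finrank ℚ M)) ℚ)
    with hγi
  have hγmi : γm * γi = 1 := by rw [hγm, hγi, ← Units.val_mul, mul_inv_cancel, Units.val_one]
  have hγim : γi * γm = 1 := by rw [hγm, hγi, ← Units.val_mul, inv_mul_cancel, Units.val_one]
  let θγ : ((Fin n × Fin (Module.finrank ℚ M)) → ℚ) ≃ₗ[ℚ] ((Fin n × Fin (Module.finrank ℚ M)) → ℚ) :=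
    LinearEquiv.ofLinear (Matrix.toLin' γm) (Matrix.toLin' γi)
      (by rw [← Matrix.toLin'_mul, hγmi, Matrix.toLin'_one])
      (by rw [← Matrix.toLin'_mul, hγim, Matrix.toLin'_one])
  let c : Module.Basis (Fin n × Fin (Module.finrank ℚ M)) ℚ (Fin n → M) := Module.Basis.ofEquivFun (e.equivFun.trans θγ)
  have hc : ∀ u, c.equivFun u = γm *ᵥ e.equivFun u := fun u => by
    rw [Module.Basis.equivFun_ofEquivFun]
    exact Matrix.toLin'_apply γm _
  obtain ⟨k, g, δ, F, T, T', hk, hg, hδ, -, hT'T, -, hβ⟩ := exists_symplecticFrameV_integral j H ξ c hH hHu hξ hξc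
  have hes : ∀ ik, e.equivFun (e ik) = Pi.single ik 1 := fun ik => by
    rw [Module.Basis.equivFun_apply, e.repr_self, Finsupp.single_eq_pi_single]
  have hP : framePV F = T.map (Int.cast : ℤ → ℚ) * γm := by
    ext a ik
    rw [framePV, LinearMap.toMatrix_apply, Pi.basisFun_repr, LinearEquiv.coe_coe, ← he, hβ, hc, hes, Matrix.mulVec_mulVec,
      Matrix.mulVec_single_one, Matrix.col_apply]
  -- the integer reading and the level
  have hS : ∀ b : 𝓞 M, ∀ i i', ∃ z : ℤ,
      (γm * resMatrix (m := Fin n) (ratBasis M) (((b : 𝓞 M) : M) • (1 : Matrix (Fin n) (Fin n) M)) * γi) i i' = (z : ℚ) := by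
    intro b i i'
    obtain ⟨a, ha⟩ := (Submodule.mem_span_range_iff_exists_fun ℤ).mp (hspan b)
    choose z hz using fun l => hγS l i i'
    refine ⟨∑ l, a l * z l, ?_⟩
    rw [← hσ, ← ha, Finset.mul_sum, Finset.sum_mul, Matrix.sum_apply, Int.cast_sum]
    refine Finset.sum_congr rfl fun l _ => ?_
    rw [mul_smul_comm, smul_mul_assoc, Matrix.smul_apply, hz l, zsmul_eq_mul, Int.cast_mul]
  obtain ⟨ρ, hρ⟩ := exists_ringHom_reading_of_framePV_eq F γ T T' hT'T hP hS
  have hγ' : ∀ p ∈ K.prod L₀,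
      (∀ i i', ((Matrix.GeneralLinearGroup.map (algebraMap ℚ finAdeleQ) γ * auxResFinV M j H p *
          (Matrix.GeneralLinearGroup.map (algebraMap ℚ finAdeleQ) γ)⁻¹ : GL (Fin n × Fin (Module.finrank ℚ M)) finAdeleQ) :
            Matrix (Fin n × Fin (Module.finrank ℚ M)) (Fin n × Fin (Module.finrank ℚ M)) finAdeleQ) i i' ∈ integralFiniteAdeles ℚ) ∧
      (∀ i i', ((Matrix.GeneralLinearGroup.map (algebraMap ℚ finAdeleQ) γ * (auxResFinV M j H p)⁻¹ *
          (Matrix.GeneralLinearGroup.map (algebraMap ℚ finAdeleQ) γ)⁻¹ : GL (Fin n × Fin (Module.finrank ℚ M)) finAdeleQ) :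
            Matrix (Fin n × Fin (Module.finrank ℚ M)) (Fin n × Fin (Module.finrank ℚ M)) finAdeleQ) i i' ∈ integralFiniteAdeles ℚ) :=
    fun p hp => hγ _ (by rw [hC]; exact Subgroup.mem_map_of_mem _ hp)
  exact ⟨k, g, δ, F, ρ, hk, hg, hδ, prod_le_auxLevelV_one_of_framePV_eq F K L₀ γ hγ' T T' hT'T hP, hρ⟩

end Main

/-! ### §2. Consequences for a reading `ρ`: Rosati over `ℤ`, the real∕adelic avatar, commutation -/

section Consequences

variable {L : Type} [Field L] {M : Type} [Field M] [NumberField M] [IsCMField M]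
  {j : L →+* M} {n : ℕ} {H : Matrix (Fin n) (Fin n) L} {ξ : M} {g : ℕ} {δ : Fin g → ℕ}
  (F : SymplecticFrameV M j H ξ g δ) (ρ : 𝓞 M →+* Matrix (Fin g ⊕ Fin g) (Fin g ⊕ Fin g) ℤ)
  (hρ : ∀ b : 𝓞 M, (ρ b).map (Int.cast : ℤ → ℚ) =
    framePV F * resMatrix (m := Fin n) (ratBasis M) (((b : 𝓞 M) : M) • (1 : Matrix (Fin n) (Fin n) M)) * frameQV F)

include hρ

/-- **ROSATI OVER `ℤ`** in the E-line's token shape (`AuxChartGS.Mρ_rosati`): for `b' = b̄`, `(ρ b')ᵀ · E_δ = E_δ · ρ b` (A-p17's ★ frame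
adjointness `transpose_frame_scalar_mul_typeFormOver` at `b'`, read through the injective `M(ℤ) → M(ℚ)`).
[cite: RapoportSmithlingZhang2020Diagonal, §4.1 p. 17] [cite: Milne2005ShimuraVarieties, §8 p. 81] -/
theorem reading_transpose_mul_typeForm (b b' : 𝓞 M) (hb' : ((b' : 𝓞 M) : M) = IsCMField.complexConj M ((b : 𝓞 M) : M)) :
    (ρ b')ᵀ * typeForm δ = typeForm δ * ρ b := by
  have hcb' : IsCMField.complexConj M ((b' : 𝓞 M) : M) = ((b : 𝓞 M) : M) := by
    rw [hb', IsCMField.complexConj_apply_apply]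
  have h := transpose_frame_scalar_mul_typeFormOver M F ((b' : 𝓞 M) : M)
  rw [hcb', ← hρ b', ← hρ b] at h
  apply map_intCast_injective'
  change ((ρ b')ᵀ * typeForm δ).map (Int.cast : ℤ → ℚ) = (typeForm δ * ρ b).map (Int.cast : ℤ → ℚ)
  rw [map_intCast_mul, map_intCast_mul, Matrix.transpose_map]
  have hE : (typeForm δ).map (Int.cast : ℤ → ℚ) = typeFormOver δ ℚ := by
    rw [typeFormOver, Int.coe_castRingHom]
  rw [hE]
  exact h

variable (R : Type) [CommRing R] [Algebra ℚ R]

/-- **The `R`-avatar of the reading is the scalar in the carrier**: `(ρ b)_R = auxRepV R β (1⊗b, 1)` for every `ℚ`-algebra `R` (`R = ℝ`: ★ E2 FILE D's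
`N_b`; `R = 𝔸_{ℚ,f}`: the adelic scalar next to ★ `auxToGspFinV`). [cite: Milne2005ShimuraVarieties, §6 p. 67, §8 p. 81] -/
theorem map_intCast_reading_eq_coe_auxRepV (b : 𝓞 M) (t : (R ⊗[ℚ] M)ˣ) (ht : (t : R ⊗[ℚ] M) = (1 : R) ⊗ₜ[ℚ] ((b : 𝓞 M) : M)) :
    (ρ b).map (Int.cast : ℤ → R) = ((auxRepV R F (t, 1) : GL (Fin g ⊕ Fin g) R) : Matrix (Fin g ⊕ Fin g) (Fin g ⊕ Fin g) R) := by
  rw [coe_auxRepV_scalar_eq_map M R F t _ ht, ← hρ b, Matrix.map_map]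
  congr 1
  funext z
  simp only [Function.comp_apply, map_intCast]

/-- **The reading commutes with the whole carrier over `R`** (E6's `Mρ_comm_auxRep`, E2's `J_Φ(v)`-linearity of the `𝒪`-action):
`(ρ b)_R · auxRepV R β p = auxRepV R β p · (ρ b)_R` for every `p`. [cite: Milne2005ShimuraVarieties, §8 p. 81] [cite: Kottwitz1992, §5 p. 390] -/
theorem map_intCast_reading_mul_coe_auxRepV_comm (b : 𝓞 M) (p : (R ⊗[ℚ] M)ˣ × GL (Fin n) (R ⊗[ℚ] M)) :
    (ρ b).map (Int.cast : ℤ → R) * ((auxRepV R F p : GL (Fin g ⊕ Fin g) R) : Matrix (Fin g ⊕ Fin g) (Fin g ⊕ Fin g) R) =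
      ((auxRepV R F p : GL (Fin g ⊕ Fin g) R) : Matrix (Fin g ⊕ Fin g) (Fin g ⊕ Fin g) R) * (ρ b).map (Int.cast : ℤ → R) := by
  by_cases hb : ((b : 𝓞 M) : M) = 0
  · have hb0 : b = 0 := by exact_mod_cast hb
    rw [hb0, map_zero, Matrix.map_zero Int.cast Int.cast_zero, Matrix.zero_mul, Matrix.mul_zero]
  · obtain ⟨t, ht⟩ := exists_tensorUnit_coe_eq_one_tmul M R ((b : 𝓞 M) : M) hb
    rw [map_intCast_reading_eq_coe_auxRepV F ρ hρ R b t ht, ← Units.val_mul, ← Units.val_mul, auxRepV_scalar_mul_comm]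

end Consequences

end AuxV

end UnitaryCurve

end Literature.AlgebraicGeometry.ShimuraVarieties

end
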